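import Mathlib
import Summits.ValiantsHypothesis.ValiantsHypothesis.Theorems.BarrierLeverPartitionMinorsHitByVPHiddenStatesFullJoinDoor

/-!
# Route BarrierLever — item `PartitionMinorsHitByVP` (stmt-ValiantsHypothesis-19717), line `hidden_states`:
# THE FULL JOIN ON THE DIAGONAL — every layout `(u, u)` makes the one-cube full hidden sum positive definite

Helper file (`--supports stmt-ValiantsHypothesis-19717`; cell valiant-natproofs, rung V4, 𝒟-side door (c), line
`Cruxes/PartitionMinorsHitByVP/Lines/hidden_states.lean` v8; prover seat val-np-p3 gen 16). Definition-free. Closes NO item.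

THE POINT (memo val-np-p3 g16 «full join» §4.1). The one-cube full-join node of `…HiddenStatesFullJoin`
(`FullJoin.Stmt.fullJoinCubePairLower`: ONE hidden cube with `K ≤ h` states, NO column selection) holds on the whole DIAGONAL
`w = u` — for EVERY injective row family `u` (lower or not), every `r`, every `h` — by positivity, with no design and no case
analysis: take `K = h`, the 0/1 table `tx (some q) a = [q = a]`, `tx none = 0`, `ty = tx`, `λ ≡ 1`. A block-additive entry is then the
inclusion indicator `∏_{a∈U} Σ_{q∈J} [q = a] = [U ⊆ J]` (`prod_zeroOne_eq`), the full hidden sum is `Σ_J [u i ⊆ J][u j ⊆ J] = (A Aᴴ)[i,j]`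
for the inclusion matrix `A[i,J] = [u i ⊆ J]` (`fullJoin_zeroOne_eq`), the rows of `A` are linearly independent for injective `u` (in a
vanishing combination, a supported row of minimal cardinality is alone at its own column; `vecMul_inclusion_injective`), so `A Aᴴ` is
positive definite (`Matrix.PosDef.mul_conjTranspose_self`) and the determinant is nonzero (`fullJoinCube_diag_det_ne_zero`). Hence the
diagonal instance of the node (`fullJoinCube_diag`) and, through the full-join door p672458, every diagonal layout `(u, u)` is hit
inside `SmallCircuits ℂ (h+h) 8` (`h ≥ 3`) by the line's ONE fixed polynomial (`partitionMinor_hit_diag`). A design-based node has no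
such uniform statement: `u` itself is a legal threshold design only when `u` is linearly separable.

WHAT THIS IS NOT: off-diagonal pairs are the content of conjecture FJ and are not touched; item 19717 stays OPEN (its diagonal layouts
are classically hit by the diagonal Nisan witness anyway); nothing on crux 14610 or VP ≠ VNP.
-/

set_option linter.dupNamespace false

namespace Summit.ValiantsHypothesis.ValiantsHypothesis.Theorems.BarrierLever.HiddenStates

open Finset Matrix
open scoped ComplexOrder
open Literature.Barriers.ValiantsHypothesis

noncomputable section

namespace FullJoin

variable {h r : ℕ}

/-- With the 0/1 table (`tx none = 0`, `tx (some q) a = [q = a]`) a block-additive factor is the inclusion indicator: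
`∏_{a ∈ U} (0 + Σ_{q ∈ J} [q = a]) = [U ⊆ J]`. -/
theorem prod_zeroOne_eq (U J : Finset (Fin h)) :
    (∏ a ∈ U, ((fun (o : Option (Fin h)) (b : Fin h) => (o.elim 0 fun q => if q = b then 1 else 0 : ℂ)) none a +
        ∑ q ∈ J, (fun (o : Option (Fin h)) (b : Fin h) => (o.elim 0 fun q => if q = b then 1 else 0 : ℂ)) (some q) a)) =
      if U ⊆ J then (1 : ℂ) else 0 := by
  classical
  have hfac : ∀ a : Fin h,
      ((fun (o : Option (Fin h)) (b : Fin h) => (o.elim 0 fun q => if q = b then 1 else 0 : ℂ)) none a +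
        ∑ q ∈ J, (fun (o : Option (Fin h)) (b : Fin h) => (o.elim 0 fun q => if q = b then 1 else 0 : ℂ)) (some q) a) =
      if a ∈ J then (1 : ℂ) else 0 := by
    intro a
    simp only [Option.elim, zero_add]
    rw [Finset.sum_ite_eq' J a]
  simp_rw [hfac]
  rw [Finset.prod_boole]
  rfl

/-- **The rows of the inclusion matrix `[u i ⊆ J]` of an injective family are linearly independent**: `v ↦ v ᵥ* A` is injective.
(In a vanishing combination, a supported index `i₀` with `|u i₀|` minimal is the only supported row that is `1` at the column `J = u i₀`.) -/
theorem vecMul_inclusion_injective (u : Fin r → Finset (Fin h)) (hu : Function.Injective u) :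
    Function.Injective
      (Matrix.of fun (i : Fin r) (J : Finset (Fin h)) => if u i ⊆ J then (1 : ℂ) else 0).vecMul := by
  classical
  set A : Matrix (Fin r) (Finset (Fin h)) ℂ := Matrix.of fun i J => if u i ⊆ J then (1 : ℂ) else 0 with hA
  -- it suffices that the kernel is trivial
  suffices hker : ∀ v : Fin r → ℂ, v ᵥ* A = 0 → v = 0 by
    intro v w hvw
    have hvw' : v ᵥ* A = w ᵥ* A := hvw
    have h0 : (v - w) ᵥ* A = 0 := by rw [Matrix.sub_vecMul, hvw', sub_self]
    exact sub_eq_zero.mp (hker _ h0)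
  intro v hv
  by_contra hne
  -- the support is nonempty; take a supported index of minimal cardinality
  have hsupp : (Finset.univ.filter fun i : Fin r => v i ≠ 0).Nonempty := by
    by_contra hempty
    rw [Finset.not_nonempty_iff_eq_empty, Finset.filter_eq_empty_iff] at hempty
    exact hne (funext fun i => by simpa using hempty (Finset.mem_univ i))
  obtain ⟨i₀, hi₀, hmin⟩ := Finset.exists_min_image _ (fun i => (u i).card) hsupp
  have hvi₀ : v i₀ ≠ 0 := (Finset.mem_filter.mp hi₀).2
  -- evaluate the vanishing combination at the column `u i₀`
  have hcol : (v ᵥ* A) (u i₀) = v i₀ := by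
    rw [Matrix.vecMul, dotProduct]
    rw [Finset.sum_eq_single i₀]
    · simp [hA]
    · intro i _ hi
      by_cases hvi : v i = 0
      · rw [hvi, zero_mul]
      · have hsub : ¬ u i ⊆ u i₀ := by
          intro hsub
          have hss : u i ⊂ u i₀ := lt_of_le_of_ne hsub (fun heq => hi (hu heq))
          have hlt : (u i).card < (u i₀).card := Finset.card_lt_card hss
          exact absurd (hmin i (Finset.mem_filter.mpr ⟨Finset.mem_univ _, hvi⟩)) (not_le.mpr hlt)
        simp [hA, hsub]
    · intro hi₀'; exact absurd (Finset.mem_univ i₀) hi₀'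
  rw [hv] at hcol
  exact hvi₀ (by simpa using hcol.symm)

/-- **The full hidden sum on the diagonal is a Gram matrix**: with `K = h`, the 0/1 table on both sides and `λ ≡ 1`, the one-cube
full-join matrix on `(u, u)` equals `A Aᴴ` for the inclusion matrix `A[i, J] = [u i ⊆ J]`. -/
theorem fullJoin_zeroOne_eq (u : Fin r → Finset (Fin h)) :
    (Matrix.of fun i j : Fin r => ∑ J : Finset (Fin h), (∏ k ∈ J, (fun _ : Fin h => (1 : ℂ)) k) *
        ((∏ a ∈ u i, ((fun (o : Option (Fin h)) (b : Fin h) => (o.elim 0 fun q => if q = b then 1 else 0 : ℂ)) none a +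
            ∑ q ∈ J, (fun (o : Option (Fin h)) (b : Fin h) => (o.elim 0 fun q => if q = b then 1 else 0 : ℂ)) (some q) a)) *
          ∏ c ∈ u j, ((fun (o : Option (Fin h)) (b : Fin h) => (o.elim 0 fun q => if q = b then 1 else 0 : ℂ)) none c +
            ∑ q ∈ J, (fun (o : Option (Fin h)) (b : Fin h) => (o.elim 0 fun q => if q = b then 1 else 0 : ℂ)) (some q) c))) =
      (Matrix.of fun (i : Fin r) (J : Finset (Fin h)) => if u i ⊆ J then (1 : ℂ) else 0) *
        (Matrix.of fun (i : Fin r) (J : Finset (Fin h)) => if u i ⊆ J then (1 : ℂ) else 0)ᴴ := by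
  classical
  refine Matrix.ext fun i j => ?_
  rw [Matrix.of_apply, Matrix.mul_apply]
  refine Finset.sum_congr rfl fun J _ => ?_
  rw [prod_zeroOne_eq, prod_zeroOne_eq, Finset.prod_const_one, one_mul, Matrix.conjTranspose_apply, Matrix.of_apply,
    Matrix.of_apply]
  congr 1
  split_ifs <;> simp

/-- **The one-cube full hidden sum is nonsingular on every diagonal layout** (`K = h`, 0/1 tables, `λ ≡ 1`): it is the positive definite
Gram matrix `A Aᴴ` of the independent rows of the inclusion matrix. -/
theorem fullJoinCube_diag_det_ne_zero (u : Fin r → Finset (Fin h)) (hu : Function.Injective u) :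
    (Matrix.of fun i j : Fin r => ∑ J : Finset (Fin h), (∏ k ∈ J, (fun _ : Fin h => (1 : ℂ)) k) *
        ((∏ a ∈ u i, ((fun (o : Option (Fin h)) (b : Fin h) => (o.elim 0 fun q => if q = b then 1 else 0 : ℂ)) none a +
            ∑ q ∈ J, (fun (o : Option (Fin h)) (b : Fin h) => (o.elim 0 fun q => if q = b then 1 else 0 : ℂ)) (some q) a)) *
          ∏ c ∈ u j, ((fun (o : Option (Fin h)) (b : Fin h) => (o.elim 0 fun q => if q = b then 1 else 0 : ℂ)) none c +
            ∑ q ∈ J, (fun (o : Option (Fin h)) (b : Fin h) => (o.elim 0 fun q => if q = b then 1 else 0 : ℂ)) (some q) c))).det ≠ 0 := by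
  classical
  rw [fullJoin_zeroOne_eq]
  set A : Matrix (Fin r) (Finset (Fin h)) ℂ := Matrix.of fun i J => if u i ⊆ J then (1 : ℂ) else 0 with hA
  have hpd : (A * Aᴴ).PosDef := Matrix.PosDef.mul_conjTranspose_self A (vecMul_inclusion_injective u hu)
  have hunit : IsUnit (A * Aᴴ) := hpd.isUnit
  rw [Matrix.isUnit_iff_isUnit_det] at hunit
  exact hunit.ne_zero

/-- **The diagonal of conjecture FJ** (`FullJoin.Stmt.fullJoinCubePairLower` at `w = u`, with `K = h ≤ h`), for EVERY injective `u`
(no lower-set hypothesis needed). -/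
theorem fullJoinCube_diag (h r : ℕ) (u : Fin r → Finset (Fin h)) (hu : Function.Injective u) :
    ∃ (K : ℕ) (tx ty : Option (Fin K) → Fin h → ℂ) (lam : Fin K → ℂ), K ≤ h ∧
      (Matrix.of fun i j : Fin r => ∑ J : Finset (Fin K), (∏ k ∈ J, lam k) *
        ((∏ a ∈ u i, (tx none a + ∑ q ∈ J, tx (some q) a)) *
          ∏ c ∈ u j, (ty none c + ∑ q ∈ J, ty (some q) c))).det ≠ 0 :=
  ⟨h, fun o b => (o.elim 0 fun q => if q = b then 1 else 0 : ℂ), fun o b => (o.elim 0 fun q => if q = b then 1 else 0 : ℂ),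
    fun _ => 1, le_rfl, fullJoinCube_diag_det_ne_zero u hu⟩

/-- **Every diagonal layout is hit by the line's one fixed polynomial** (through the full-join door p672458): for `h ≥ 3` and every
injective `u : Fin r → Finset (Fin h)` some `f ∈ SmallCircuits ℂ (h+h) 8` — the truncated one-cube hidden-state witness with `K = h`
states, 0/1 table and unit weights — has a nonsingular partition matrix on `(u, u)`. -/
theorem partitionMinor_hit_diag (h r : ℕ) (hh : 3 ≤ h) (u : Fin r → Finset (Fin h)) (hu : Function.Injective u) :
    ∃ f ∈ SmallCircuits ℂ (h + h) 8,
      (Matrix.of fun i j : Fin r => MvPolynomial.coeff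
        (∑ a ∈ u i, Finsupp.single (Fin.castAdd h a) 1 +
          ∑ c ∈ u j, Finsupp.single (Fin.natAdd h c) 1) f).det ≠ 0 := by
  classical
  set tx : Option (Fin h) → Fin h → ℂ := fun o b => (o.elim 0 fun q => if q = b then 1 else 0 : ℂ) with htx
  have hdet := fullJoinCube_diag_det_ne_zero u hu
  refine partitionMinor_hit_of_fullJoin_mem h 1 h r hh (by omega) ?_ u u (fun _ => tx) (fun _ => tx) (fun _ => 1)
    (fun _ _ => 1) ?_
  · calc h = h * 1 * 1 := by ring
      _ ≤ h * h * h := by gcongr <;> omega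
  · have hmat : (Matrix.of fun i j : Fin r => ∑ p : Fin 1, ∑ J : Finset (Fin h),
        (fun _ : Fin 1 => (1 : ℂ)) p * (∏ k ∈ J, (fun (_ : Fin 1) (_ : Fin h) => (1 : ℂ)) p k) *
        ((∏ a ∈ u i, ((fun _ : Fin 1 => tx) p none a + ∑ q ∈ J, (fun _ : Fin 1 => tx) p (some q) a)) *
          ∏ c ∈ u j, ((fun _ : Fin 1 => tx) p none c + ∑ q ∈ J, (fun _ : Fin 1 => tx) p (some q) c))) =
        Matrix.of fun i j : Fin r => ∑ J : Finset (Fin h), (∏ k ∈ J, (fun _ : Fin h => (1 : ℂ)) k) *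
          ((∏ a ∈ u i, (tx none a + ∑ q ∈ J, tx (some q) a)) *
            ∏ c ∈ u j, (tx none c + ∑ q ∈ J, tx (some q) c)) := by
      refine Matrix.ext fun i j => ?_
      simp only [Matrix.of_apply, Fin.sum_univ_one, one_mul]
    rw [hmat, htx]
    exact hdet

end FullJoin

end

end Summit.ValiantsHypothesis.ValiantsHypothesis.Theorems.BarrierLever.HiddenStates

namespace Summit.ValiantsHypothesis.ValiantsHypothesis.Theorems.BarrierLever.HiddenStates

open Finset Matrix
open scoped ComplexOrder
open Literature.Barriers.ValiantsHypothesis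

noncomputable section

namespace FullJoin

variable {h r : ℕ}

/-- With the RELABELLED 0/1 table (`ty none = 0`, `ty (some q) c = [σ q = c]`) on a relabelled set, the block-additive factor is again the
inclusion indicator of the original set: `∏_{c ∈ σ(U)} (0 + Σ_{q ∈ J} [σ q = c]) = [U ⊆ J]`. -/
theorem prod_zeroOne_perm_eq (σ : Equiv.Perm (Fin h)) (U J : Finset (Fin h)) :
    (∏ c ∈ U.map σ.toEmbedding,
        ((fun (o : Option (Fin h)) (b : Fin h) => (o.elim 0 fun q => if σ q = b then 1 else 0 : ℂ)) none c +
          ∑ q ∈ J, (fun (o : Option (Fin h)) (b : Fin h) => (o.elim 0 fun q => if σ q = b then 1 else 0 : ℂ)) (some q) c)) =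
      if U ⊆ J then (1 : ℂ) else 0 := by
  classical
  rw [Finset.prod_map]
  have hfac : ∀ a : Fin h,
      ((fun (o : Option (Fin h)) (b : Fin h) => (o.elim 0 fun q => if σ q = b then 1 else 0 : ℂ)) none (σ.toEmbedding a) +
        ∑ q ∈ J, (fun (o : Option (Fin h)) (b : Fin h) => (o.elim 0 fun q => if σ q = b then 1 else 0 : ℂ)) (some q)
          (σ.toEmbedding a)) =
      if a ∈ J then (1 : ℂ) else 0 := by
    intro a
    simp only [Option.elim, zero_add, Equiv.toEmbedding_apply, EmbeddingLike.apply_eq_iff_eq]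
    rw [Finset.sum_ite_eq' J a]
  simp_rw [hfac]
  rw [Finset.prod_boole]
  rfl

/-- **FJ for ISOMORPHIC pairs.** If `w` is a coordinate relabelling of `u` (`w j = σ(u j)` for a permutation `σ` of `Fin h`), then the
one-cube full hidden sum on `(u, w)` is nonsingular (with `K = h`, the 0/1 table for `u`, the `σ`-relabelled 0/1 table for `w`, unit
weights): it is the same Gram matrix `A Aᴴ` as on the diagonal. -/
theorem fullJoinCube_perm_det_ne_zero (σ : Equiv.Perm (Fin h)) (u w : Fin r → Finset (Fin h)) (hu : Function.Injective u)
    (hw : ∀ j, w j = (u j).map σ.toEmbedding) :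
    (Matrix.of fun i j : Fin r => ∑ J : Finset (Fin h), (∏ k ∈ J, (fun _ : Fin h => (1 : ℂ)) k) *
        ((∏ a ∈ u i, ((fun (o : Option (Fin h)) (b : Fin h) => (o.elim 0 fun q => if q = b then 1 else 0 : ℂ)) none a +
            ∑ q ∈ J, (fun (o : Option (Fin h)) (b : Fin h) => (o.elim 0 fun q => if q = b then 1 else 0 : ℂ)) (some q) a)) *
          ∏ c ∈ w j, ((fun (o : Option (Fin h)) (b : Fin h) => (o.elim 0 fun q => if σ q = b then 1 else 0 : ℂ)) none c +
            ∑ q ∈ J, (fun (o : Option (Fin h)) (b : Fin h) => (o.elim 0 fun q => if σ q = b then 1 else 0 : ℂ)) (some q) c))).det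
      ≠ 0 := by
  classical
  have hmat : (Matrix.of fun i j : Fin r => ∑ J : Finset (Fin h), (∏ k ∈ J, (fun _ : Fin h => (1 : ℂ)) k) *
        ((∏ a ∈ u i, ((fun (o : Option (Fin h)) (b : Fin h) => (o.elim 0 fun q => if q = b then 1 else 0 : ℂ)) none a +
            ∑ q ∈ J, (fun (o : Option (Fin h)) (b : Fin h) => (o.elim 0 fun q => if q = b then 1 else 0 : ℂ)) (some q) a)) *
          ∏ c ∈ w j, ((fun (o : Option (Fin h)) (b : Fin h) => (o.elim 0 fun q => if σ q = b then 1 else 0 : ℂ)) none c +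
            ∑ q ∈ J, (fun (o : Option (Fin h)) (b : Fin h) => (o.elim 0 fun q => if σ q = b then 1 else 0 : ℂ)) (some q) c))) =
      (Matrix.of fun i j : Fin r => ∑ J : Finset (Fin h), (∏ k ∈ J, (fun _ : Fin h => (1 : ℂ)) k) *
        ((∏ a ∈ u i, ((fun (o : Option (Fin h)) (b : Fin h) => (o.elim 0 fun q => if q = b then 1 else 0 : ℂ)) none a +
            ∑ q ∈ J, (fun (o : Option (Fin h)) (b : Fin h) => (o.elim 0 fun q => if q = b then 1 else 0 : ℂ)) (some q) a)) *
          ∏ c ∈ u j, ((fun (o : Option (Fin h)) (b : Fin h) => (o.elim 0 fun q => if q = b then 1 else 0 : ℂ)) none c +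
            ∑ q ∈ J, (fun (o : Option (Fin h)) (b : Fin h) => (o.elim 0 fun q => if q = b then 1 else 0 : ℂ)) (some q) c))) := by
    refine Matrix.ext fun i j => ?_
    simp only [Matrix.of_apply]
    refine Finset.sum_congr rfl fun J _ => ?_
    rw [hw j, prod_zeroOne_perm_eq, prod_zeroOne_eq (u j) J]
  rw [hmat]
  exact fullJoinCube_diag_det_ne_zero u hu

/-- **FJ for isomorphic pairs, node form**: the body of `FullJoin.Stmt.fullJoinCubePairLower` (with `K = h`) for every pair `(u, σ∘u)`,
every injective `u` (no lower-set hypothesis). -/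
theorem fullJoinCube_perm (h r : ℕ) (σ : Equiv.Perm (Fin h)) (u w : Fin r → Finset (Fin h)) (hu : Function.Injective u)
    (hw : ∀ j, w j = (u j).map σ.toEmbedding) :
    ∃ (K : ℕ) (tx ty : Option (Fin K) → Fin h → ℂ) (lam : Fin K → ℂ), K ≤ h ∧
      (Matrix.of fun i j : Fin r => ∑ J : Finset (Fin K), (∏ k ∈ J, lam k) *
        ((∏ a ∈ u i, (tx none a + ∑ q ∈ J, tx (some q) a)) *
          ∏ c ∈ w j, (ty none c + ∑ q ∈ J, ty (some q) c))).det ≠ 0 :=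
  ⟨h, fun o b => (o.elim 0 fun q => if q = b then 1 else 0 : ℂ), fun o b => (o.elim 0 fun q => if σ q = b then 1 else 0 : ℂ),
    fun _ => 1, le_rfl, fullJoinCube_perm_det_ne_zero σ u w hu hw⟩

/-- **Every layout isomorphic to a diagonal one is hit** by the line's one fixed polynomial (`h ≥ 3`, `b = 8`). -/
theorem partitionMinor_hit_perm (h r : ℕ) (hh : 3 ≤ h) (σ : Equiv.Perm (Fin h)) (u w : Fin r → Finset (Fin h))
    (hu : Function.Injective u) (hw : ∀ j, w j = (u j).map σ.toEmbedding) :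
    ∃ f ∈ SmallCircuits ℂ (h + h) 8,
      (Matrix.of fun i j : Fin r => MvPolynomial.coeff
        (∑ a ∈ u i, Finsupp.single (Fin.castAdd h a) 1 +
          ∑ c ∈ w j, Finsupp.single (Fin.natAdd h c) 1) f).det ≠ 0 := by
  classical
  set tx : Option (Fin h) → Fin h → ℂ := fun o b => (o.elim 0 fun q => if q = b then 1 else 0 : ℂ) with htx
  set ty : Option (Fin h) → Fin h → ℂ := fun o b => (o.elim 0 fun q => if σ q = b then 1 else 0 : ℂ) with hty
  have hdet := fullJoinCube_perm_det_ne_zero σ u w hu hw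
  refine partitionMinor_hit_of_fullJoin_mem h 1 h r hh (by omega) ?_ u w (fun _ => tx) (fun _ => ty) (fun _ => 1)
    (fun _ _ => 1) ?_
  · calc h = h * 1 * 1 := by ring
      _ ≤ h * h * h := by gcongr <;> omega
  · have hmat : (Matrix.of fun i j : Fin r => ∑ p : Fin 1, ∑ J : Finset (Fin h),
        (fun _ : Fin 1 => (1 : ℂ)) p * (∏ k ∈ J, (fun (_ : Fin 1) (_ : Fin h) => (1 : ℂ)) p k) *
        ((∏ a ∈ u i, ((fun _ : Fin 1 => tx) p none a + ∑ q ∈ J, (fun _ : Fin 1 => tx) p (some q) a)) *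
          ∏ c ∈ w j, ((fun _ : Fin 1 => ty) p none c + ∑ q ∈ J, (fun _ : Fin 1 => ty) p (some q) c))) =
        Matrix.of fun i j : Fin r => ∑ J : Finset (Fin h), (∏ k ∈ J, (fun _ : Fin h => (1 : ℂ)) k) *
          ((∏ a ∈ u i, (tx none a + ∑ q ∈ J, tx (some q) a)) *
            ∏ c ∈ w j, (ty none c + ∑ q ∈ J, ty (some q) c)) := by
      refine Matrix.ext fun i j => ?_
      simp only [Matrix.of_apply, Fin.sum_univ_one, one_mul]
    rw [hmat, htx, hty]
    exact hdet

end FullJoin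

end

end Summit.ValiantsHypothesis.ValiantsHypothesis.Theorems.BarrierLever.HiddenStates
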